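import Literature.Probability.RandomPlanarGeometry.SlitLoewnerChain
import Literature.Probability.RandomPlanarGeometry.LoewnerDescriptionProofs
import HarnessLib

/-!
# Nested slits have one driving function; hulls at intermediate times; the height of a hull

G. F. Lawler, *Conformally Invariant Processes in the Plane*, AMS (2005), §4.1: for a simple
curve `γ` from a real point with `γ(0, ∞) ⊂ ℍ`, the maps `g_t = g_{γ(0,t]}`, the capacity
`b(t) = hcap γ(0, t]` and the driving function `U_t = g_t(γ(t))` are INTRINSIC to the curve
(Prop. 3.36: "`g_A` is the unique conformal transformation of `ℍ ∖ A` onto `ℍ` such that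
`lim (g_A(z) - z) = 0`"), and Prop. 4.4 / Remark 4.5 give the chordal Loewner chain of the curve
parametrized by capacity, `K_t = γ̃(0, t]` for ALL `t`. The tree's slit theorem
(`SlitLoewnerChain`: `IsPlusSlit γ` on `[0, 1]`, `IsPlusSlit.hull_driving : K_S = γ(0, 1]` at the
terminal time `S = b(1)/2`) is completed here by the statements needed to parametrize an
UNBOUNDED curve by capacity through its compact initial pieces (used for the UST Peano curve of
Lawler–Schramm–Werner (2004), Thm. 4.4, in `LSW2004USTProofs`):

* `IsHydrodynamicMap.eqOn` — **uniqueness of the hydrodynamically normalized map** `g_A`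
  (Prop. 3.36; the tree had uniqueness of `hcap` only, `IsHydrodynamicMap.hcap_eq_hcap`), by the
  rigidity theorem `Complex.eqOn_id_of_tendsto_sub_self` applied to `φ₂ ∘ φ₁⁻¹`;
* `Loewner.hull_eq_hull_of_eqOn` — **the hull `K_t` depends only on `W|[0, t]`**;
* `Loewner.im_sq_le_of_mem_hull` — **`(im z)² ≤ 4t` for `z ∈ K_t`** (Thm. 4.6, proof:
  "`Im[g_t(z)]` decreases with `t`"; quantitatively `∂_t (im g_t)² ≥ -4`, so a point of height
  `> 2√t` stays `δ`-far from the driving function and is not swallowed by time `t`), i.e.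
  `hcap K ≥ (im z)²/2` for the hulls of a chain — the estimate that forces the capacity of a
  curve running to `∞` inside a sector to diverge;
* `IsPlusSlit.hull_driving_of_le` — **`K_t = γ(0, σ(t)]` for every `t ∈ (0, S]`**, not only at
  the terminal time (same proof as `hull_driving`, `Loewner.hull_eq_of_flow`);
* `IsPlusSlit.initial`, `IsPlusSlit.cap_initial`, `…timeChange_initial`, `…drive_initial`,
  `…driving_initial` — **the initial piece `γ ∘ (v ·)` (`0 < v ≤ 1`) of a slit is a slit with
  `b'(u) = b(vu)`, `σ = v σ'`, `U'_u = U_{vu}` and THE SAME driving function in capacity time on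
  `[0, b(v)/2]`** (uniqueness of `g_A` and `U_u = lim_{t ↓ u} g_u(γ(t))`, Lemma 4.2).

## References

* G. F. Lawler (2005), §3.4 Prop. 3.36, §4.1 Lemma 4.2, Prop. 4.4, Remark 4.5, Thm. 4.6 [Lawler2005].
-/

noncomputable section

open Set Filter Metric Complex Bornology Function
open _root_.Topology
open UpperHalfPlane (upperHalfPlaneSet isOpen_upperHalfPlaneSet)
open scoped NNReal

namespace Literature.Probability.RandomPlanarGeometry

/-! ### Uniqueness of the hydrodynamically normalized map -/

namespace IsHydrodynamicMap

variable {K : Set ℂ} {φ₁ φ₂ : ConformalEquiv (upperHalfPlaneSet \ K) upperHalfPlaneSet}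

/-- `φ⁻¹(w) → ∞` in `ℍ ∖ K` as `w → ∞` in `ℍ` (the inverse is normalized too,
`tendsto_symm_sub_self`). [folklore] -/
theorem tendsto_symm_cocompact_inf (h₁ : IsHydrodynamicMap K φ₁)
    (hb : IsBounded (K ∩ upperHalfPlaneSet)) :
    Tendsto φ₁.symm (cocompact ℂ ⊓ 𝓟 upperHalfPlaneSet)
      (cocompact ℂ ⊓ 𝓟 (upperHalfPlaneSet \ K)) := by
  refine tendsto_inf.2 ⟨tendsto_cocompact_of_sub_self inf_le_left (h₁.tendsto_symm_sub_self hb),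
    tendsto_principal.2 ?_⟩
  filter_upwards [mem_inf_of_right (mem_principal_self _)] with w hw
  exact φ₁.symm_mapsTo hw

/-- **Uniqueness of `g_A`** (Lawler (2005), Prop. 3.36: the hydrodynamically normalized conformal
transformation `ℍ ∖ A → ℍ` is unique): two hydrodynamically normalized conformal equivalences
`ℍ ∖ K → ℍ` agree on `ℍ ∖ K`. Proof: `g = φ₂ ∘ φ₁⁻¹` and its inverse are holomorphic self-maps
of `ℍ` with `g(w) - w → 0` at `∞`, hence `g = id` (`Complex.eqOn_id_of_tendsto_sub_self`).
[cite: Lawler2005, §3.4 Prop. 3.36] -/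
theorem eqOn (h₁ : IsHydrodynamicMap K φ₁) (h₂ : IsHydrodynamicMap K φ₂)
    (hb : IsBounded (K ∩ upperHalfPlaneSet)) : EqOn φ₁ φ₂ (upperHalfPlaneSet \ K) := by
  have key : ∀ {ψ₁ ψ₂ : ConformalEquiv (upperHalfPlaneSet \ K) upperHalfPlaneSet},
      IsHydrodynamicMap K ψ₁ → IsHydrodynamicMap K ψ₂ →
      DifferentiableOn ℂ (fun w ↦ ψ₂ (ψ₁.symm w)) upperHalfPlaneSet ∧
        MapsTo (fun w ↦ ψ₂ (ψ₁.symm w)) upperHalfPlaneSet upperHalfPlaneSet ∧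
        Tendsto (fun w ↦ ψ₂ (ψ₁.symm w) - w) (cocompact ℂ ⊓ 𝓟 upperHalfPlaneSet) (𝓝 0) := by
    intro ψ₁ ψ₂ hψ₁ hψ₂
    refine ⟨ψ₂.differentiableOn.comp ψ₁.symm.differentiableOn ψ₁.symm_mapsTo,
      ψ₂.mapsTo.comp ψ₁.symm_mapsTo, ?_⟩
    have h1 := (hψ₂.comp (hψ₁.tendsto_symm_cocompact_inf hb)).add (hψ₁.tendsto_symm_sub_self hb)
    rw [add_zero] at h1
    refine h1.congr fun w ↦ ?_
    simp only [Function.comp_apply]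
    ring
  obtain ⟨hg, hgm, hgl⟩ := key h₁ h₂
  obtain ⟨hG, hGm, hGl⟩ := key h₂ h₁
  have hGg : LeftInvOn (fun w ↦ φ₁ (φ₂.symm w)) (fun w ↦ φ₂ (φ₁.symm w)) upperHalfPlaneSet := by
    intro w hw
    have hz : φ₁.symm w ∈ upperHalfPlaneSet \ K := φ₁.symm_mapsTo hw
    simp only
    rw [φ₂.symm_apply_apply hz, φ₁.apply_symm_apply hw]
  have hid := Complex.eqOn_id_of_tendsto_sub_self hg hgm hgl hG hGm hGl hGg
  intro z hz
  have h1 := hid (φ₁.mapsTo hz)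
  simp only [id_eq] at h1
  rw [φ₁.symm_apply_apply hz] at h1
  exact h1.symm

/-- Uniqueness of `g_A`, transported along an equality of hulls `K = K'`. [folklore] -/
theorem eqOn_of_eq {K' : Set ℂ} (e : K = K')
    {φ : ConformalEquiv (upperHalfPlaneSet \ K) upperHalfPlaneSet}
    {φ' : ConformalEquiv (upperHalfPlaneSet \ K') upperHalfPlaneSet} (h : IsHydrodynamicMap K φ)
    (h' : IsHydrodynamicMap K' φ') (hb : IsBounded (K ∩ upperHalfPlaneSet)) :
    EqOn φ φ' (upperHalfPlaneSet \ K) := by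
  subst e
  exact h.eqOn h' hb

/-- The half-plane capacity is intrinsic to the hull, transported along `K = K'`
(`hcap_eq_hcap`). [folklore] -/
theorem hcap_eq_of_eq {K' : Set ℂ} (e : K = K')
    {φ : ConformalEquiv (upperHalfPlaneSet \ K) upperHalfPlaneSet}
    {φ' : ConformalEquiv (upperHalfPlaneSet \ K') upperHalfPlaneSet} (h : IsHydrodynamicMap K φ)
    (h' : IsHydrodynamicMap K' φ') (hb : IsBounded (K ∩ upperHalfPlaneSet)) :
    hcap K φ = hcap K' φ' := by
  subst e
  exact h.hcap_eq_hcap h' hb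

end IsHydrodynamicMap

/-! ### Hulls depend only on the past of the driving function; the height of a hull -/

namespace Loewner

variable {W W' : ℝ≥0 → ℝ}

/-- One inclusion of `hull_eq_hull_of_eqOn`: if `W = W'` on `[0, t]` then `K'_t ⊆ K_t`. A
point flowing under `W` beyond `t` has its `W`-solution solve the `W'`-equation in `ℍ` on the
closed interval `[0, t]`, so it is not swallowed by `W'` at time `t`
(`coe_lt_swallowingTime_of_hasDerivWithinAt`). [cite: Lawler2005, Ch. 4 §4.1 Thm. 4.6] -/
theorem hull_subset_hull_of_eqOn (hW : Continuous W) (hW' : Continuous W') {t : ℝ≥0}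
    (h : ∀ s : ℝ≥0, s ≤ t → W s = W' s) : hull W' t ⊆ hull W t := by
  intro z hz
  refine ⟨hz.1, ?_⟩
  by_contra hlt
  rw [not_le] at hlt
  rcases eq_or_lt_of_le (show (0 : ℝ≥0) ≤ t from bot_le) with ht0 | ht0
  · have h0 := hull_zero_holds hW'
    rw [← ht0, h0] at hz
    exact hz
  have hzH : 0 < z.im := hz.1
  have hz0 : z ≠ W 0 := fun h0 ↦ by
    rw [h0, ofReal_im] at hzH
    exact lt_irrefl _ hzH
  obtain ⟨g, hg⟩ := exists_isSolution_swallowingTime_holds hW hz0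
  have hsub : Icc (0 : ℝ) t ⊆ {s : ℝ | 0 ≤ s ∧ (s.toNNReal : WithTop ℝ≥0) < swallowingTime W z} :=
    Icc_subset_timeDomain (by simpa using hlt)
  have hder : ∀ s ∈ Icc (0 : ℝ) t,
      HasDerivWithinAt g (2 / (g s - W' s.toNNReal)) (Icc (0 : ℝ) t) s := by
    intro s hs
    have h1 := (hg.isIntegralCurveOn s (hsub hs)).mono hsub
    have hs' : W s.toNNReal = W' s.toNNReal :=
      h _ (Real.toNNReal_le_iff_le_coe.2 hs.2)
    rw [vectorField_apply, hs'] at h1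
    exact h1
  have hH : ∀ s ∈ Icc (0 : ℝ) t, g s ∈ upperHalfPlaneSet := fun s hs ↦
    IsSolution.im_pos_holds hW hg hzH s hs.1 (hsub hs).2
  have key := coe_lt_swallowingTime_of_hasDerivWithinAt hW' ht0 hg.apply_zero hder hH
  exact absurd hz.2 (not_le.2 key)

/-- **The hull `K_t` depends only on `W|[0, t]`**: two continuous driving functions that agree
on `[0, t]` have the same hull at time `t` (the Loewner equation up to time `t` only sees
`W|[0, t]`; Lawler (2005), Thm. 4.6). [cite: Lawler2005, Ch. 4 §4.1 Thm. 4.6] -/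
theorem hull_eq_hull_of_eqOn (hW : Continuous W) (hW' : Continuous W') {t : ℝ≥0}
    (h : ∀ s : ℝ≥0, s ≤ t → W s = W' s) : hull W t = hull W' t :=
  (hull_subset_hull_of_eqOn hW' hW fun s hs ↦ (h s hs).symm).antisymm
    (hull_subset_hull_of_eqOn hW hW' h)

/-- **The height of a hull: `(im z)² ≤ 4t` for `z ∈ K_t`** (continuous driving function).
Lawler (2005), proof of Thm. 4.6: "`Im[g_t(z)]` decreases with `t`, and
`T_z = sup{t : Im[g_t(z)] > 0}`"; quantitatively `∂_t im g_t = -2 im g_t/|g_t - W_t|² ≥ -2/im g_t`,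
so `(im g_t)² ≥ (im z)² - 4t`, and while this is positive the solution stays
`√((im z)² - 4T_z)`-far from the driving function and extends past `T_z`
(`IsSolution.coe_lt_swallowingTime_of_le_norm_sub`) — unless `(im z)² ≤ 4 T_z ≤ 4t`.
Equivalently `hcap K_t = 2t ≥ (im z)²/2`. [cite: Lawler2005, Ch. 4 §4.1 Thm. 4.6] -/
theorem im_sq_le_of_mem_hull (hW : Continuous W) {t : ℝ≥0} {z : ℂ} (hz : z ∈ hull W t) :
    z.im ^ 2 ≤ 4 * t := by
  have hzH : 0 < z.im := hz.1
  have hz0 : z ≠ W 0 := fun h0 ↦ by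
    rw [h0, ofReal_im] at hzH
    exact lt_irrefl _ hzH
  have hTt : swallowingTime W z ≤ t := hz.2
  have hTtop : swallowingTime W z ≠ ⊤ := ne_top_of_le_ne_top WithTop.coe_ne_top hTt
  obtain ⟨b, hb⟩ : ∃ b : ℝ≥0, (b : WithTop ℝ≥0) = swallowingTime W z :=
    WithTop.ne_top_iff_exists.1 hTtop
  have hbt : b ≤ t := by
    rw [← hb] at hTt
    exact_mod_cast hTt
  have hb0 : 0 < b := by
    have := swallowingTime_pos_holds hW hz0
    rw [← hb] at this
    exact_mod_cast this
  suffices hmain : z.im ^ 2 ≤ 4 * b by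
    have : (4 : ℝ) * b ≤ 4 * t := by
      have : (b : ℝ) ≤ t := hbt
      linarith
    exact hmain.trans this
  by_contra hcon
  rw [not_le] at hcon
  obtain ⟨g, hg⟩ := exists_isSolution_swallowingTime_holds hW hz0
  rw [← hb] at hg
  set δ : ℝ := Real.sqrt (z.im ^ 2 - 4 * b) with hδdef
  have hδ : 0 < δ := Real.sqrt_pos.2 (by linarith)
  -- `F(s) = (im g s)² + 4 s` is nondecreasing on the time domain
  set D : Set ℝ := {s : ℝ | 0 ≤ s ∧ (s.toNNReal : WithTop ℝ≥0) < (b : WithTop ℝ≥0)} with hD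
  have hconv : Convex ℝ D := (ordConnected_timeDomain _).convex
  have hy : ∀ s ∈ D, HasDerivWithinAt (fun s ↦ (g s).im)
      (-2 * (g s).im / Complex.normSq (g s - W s.toNNReal)) D s := fun s hs ↦ by
    have h1 := hg.isIntegralCurveOn s hs
    have h2 : HasDerivWithinAt (fun s ↦ (g s).im) (vectorField W s (g s)).im D s :=
      Complex.imCLM.hasFDerivAt.comp_hasDerivWithinAt s h1
    rwa [im_vectorField] at h2
  have hF : ∀ s ∈ D, HasDerivWithinAt (fun s ↦ (g s).im ^ 2 + 4 * s)
      (((2 : ℕ) : ℝ) * (g s).im ^ (2 - 1) * (-2 * (g s).im / Complex.normSq (g s - W s.toNNReal)) +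
        4 * 1) D s :=
    fun s hs ↦ ((hy s hs).pow 2).add ((hasDerivWithinAt_id s D).const_mul 4)
  have hmono : MonotoneOn (fun s ↦ (g s).im ^ 2 + 4 * s) D := by
    refine monotoneOn_of_hasDerivWithinAt_nonneg hconv
      (fun s hs ↦ (hF s hs).continuousWithinAt)
      (fun s hs ↦ (hF s (interior_subset hs)).mono interior_subset) fun s _ ↦ ?_
    set N : ℝ := Complex.normSq (g s - W s.toNNReal) with hN
    have hNnonneg : 0 ≤ N := Complex.normSq_nonneg _
    have himN : (g s).im ^ 2 ≤ N := by
      rw [hN, Complex.normSq_apply, sub_im, ofReal_im, sub_zero]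
      nlinarith [sq_nonneg ((g s - W s.toNNReal).re)]
    have h1 : (g s).im ^ 2 / N ≤ 1 := div_le_one_of_le₀ himN hNnonneg
    have h2 : ((2 : ℕ) : ℝ) * (g s).im ^ (2 - 1) * (-2 * (g s).im / N) + 4 * 1 =
        4 - 4 * ((g s).im ^ 2 / N) := by
      push_cast
      ring
    rw [h2]
    linarith
  -- hence the solution stays `δ`-far from the driving function on `[0, b)`
  have hfar : ∀ s : ℝ, 0 ≤ s → s < b → (δ : ℝ) ≤ ‖g s - W s.toNNReal‖ := by
    intro s hs0 hsb
    have hsD : s ∈ D := mem_timeDomain_coe_iff.2 ⟨hs0, hsb⟩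
    have h0D : (0 : ℝ) ∈ D := mem_timeDomain_coe_iff.2 ⟨le_rfl, hb0⟩
    have h1 := hmono h0D hsD hs0
    simp only [hg.apply_zero, mul_zero, add_zero] at h1
    have himpos : 0 < (g s).im := IsSolution.im_pos_holds hW hg hzH s hs0 hsD.2
    have h2 : δ ^ 2 ≤ (g s).im ^ 2 := by
      rw [hδdef, Real.sq_sqrt (by linarith)]
      have : (s : ℝ) < b := hsb
      linarith
    have h3 : δ ≤ (g s).im := (pow_le_pow_iff_left₀ hδ.le himpos.le two_ne_zero).1 h2
    calc δ ≤ (g s).im := h3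
      _ = (g s - W s.toNNReal).im := by rw [sub_im, ofReal_im, sub_zero]
      _ ≤ |(g s - W s.toNNReal).im| := le_abs_self _
      _ ≤ ‖g s - W s.toNNReal‖ := Complex.abs_im_le_norm _
  have key := hg.coe_lt_swallowingTime_of_le_norm_sub hW hb0 (δ := ⟨δ, hδ.le⟩) hδ hfar
  rw [← hb] at key
  exact lt_irrefl _ key

/-- The height bound in the form used for capacity estimates: a hull at time `t` containing a
point of imaginary part `≥ m ≥ 0` has `m² ≤ 4t`. [cite: Lawler2005, Ch. 4 §4.1 Thm. 4.6] -/
theorem sq_le_of_le_im_of_mem_hull (hW : Continuous W) {t : ℝ≥0} {z : ℂ} (hz : z ∈ hull W t)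
    {m : ℝ} (hm : 0 ≤ m) (hmz : m ≤ z.im) : m ^ 2 ≤ 4 * t :=
  (pow_le_pow_left₀ hm hmz 2).trans (im_sq_le_of_mem_hull hW hz)

end Loewner

/-! ### The hulls of a slit at intermediate times -/

namespace IsPlusSlit

variable {γ : ℝ → ℂ} (h : IsPlusSlit γ)

/-- **`K_t = γ(0, σ(t)]` for every `t ∈ (0, S]`**: the hull of the chordal Loewner chain driven
by the driving function of the slit, at any time up to the terminal capacity time, is the
initial arc of capacity `2t` (Lawler (2005), Prop. 4.4 with Remark 4.5 and Thm. 4.6; the tree's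
`hull_driving` is the case `t = S`). Same proof: off `γ(0, σ(t)]` the flow `g_{σ(·)}(z)`
solves the equation in `ℍ` on `[0, t]` (for `z = γ(s)`, `s > σ(t)`, use an intermediate
parameter `u* ∈ (σ(t), s)`), and `γ(s)`, `s ≤ σ(t)`, hits the driving function at
`b(s)/2 ≤ t`. [cite: Lawler2005, Prop. 4.4] -/
theorem hull_driving_of_le {t : ℝ≥0} (ht0 : 0 < t) (htS : (t : ℝ) ≤ h.capTime) :
    Loewner.hull h.driving t = γ '' Ioc 0 (h.timeChange t) := by
  have ht0' : (0 : ℝ) < t := ht0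
  set u₀ : ℝ := h.timeChange t with hu₀
  have hu₀mem : u₀ ∈ Icc (0 : ℝ) 1 := h.timeChange_mem ⟨ht0'.le, htS⟩
  have hK : γ '' Ioc 0 u₀ ⊆ upperHalfPlaneSet := by
    rintro _ ⟨s, hs, rfl⟩
    exact h.im_pos s ⟨hs.1, hs.2.trans hu₀mem.2⟩
  refine Loewner.hull_eq_of_flow h.continuous_driving ht0 hK (G := h.flow) (fun z ↦ h.flow_zero z)
    (fun z hz ↦ ?_) (fun z hz ↦ ?_)
  · -- off `γ(0, u₀]`: a parameter `u*` with `z ∉ γ[0, u*]` and `t ≤ b(u*)/2`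
    have main : ∃ us : ℝ, us ∈ Ioc (0 : ℝ) 1 ∧ z ∈ upperHalfPlaneSet \ h.hull us ∧
        (t : ℝ) ≤ h.cap us / 2 := by
      by_cases hz1 : z ∈ h.hull 1
      · obtain ⟨s, hs, rfl⟩ := hz1
        have hs0 : 0 < s := by
          rcases hs.1.eq_or_lt with heq | hpos
          · exact absurd (heq ▸ h.im_zero : (γ s).im = 0) (ne_of_gt hz.1)
          · exact hpos
        have hus : u₀ < s := by
          by_contra hle
          rw [not_lt] at hle
          exact hz.2 ⟨s, ⟨hs0, hle⟩, rfl⟩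
        refine ⟨(u₀ + s) / 2, ⟨by linarith [hu₀mem.1], by linarith [hs.2]⟩,
          h.apply_mem_diff (by linarith [hu₀mem.1]) (by linarith) hs.2, ?_⟩
        have h1 : h.cap u₀ < h.cap ((u₀ + s) / 2) :=
          h.strictMonoOn_cap hu₀mem ⟨by linarith [hu₀mem.1], by linarith [hs.2]⟩ (by linarith)
        rw [h.cap_timeChange ⟨ht0'.le, htS⟩] at h1
        linarith
      · exact ⟨1, ⟨one_pos, le_rfl⟩, ⟨hz.1, hz1⟩, htS⟩
    obtain ⟨us, hus, hzus, htus⟩ := main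
    exact ⟨fun s hs ↦ (h.hasDerivWithinAt_flow hus hzus ⟨hs.1, hs.2.trans htus⟩).mono
      (Icc_subset_Icc_right htus), fun s hs ↦ h.flow_mem ⟨hus.1.le, hus.2⟩ hzus ⟨hs.1, hs.2.trans htus⟩⟩
  · -- on `γ(0, u₀]`: hit at the capacity time `b(s)/2 ≤ t`
    obtain ⟨s, hs, rfl⟩ := hz
    have hs1 : s ≤ 1 := hs.2.trans hu₀mem.2
    have hτ : 0 < h.cap s / 2 := by linarith [h.cap_pos hs.1 hs1]
    refine ⟨(h.cap s / 2).toNNReal, by simpa using hτ, ?_, h.isSolution_flow_apply ⟨hs.1, hs1⟩, ?_⟩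
    · rw [← NNReal.coe_le_coe, Real.coe_toNNReal _ hτ.le]
      have h1 : h.cap s ≤ h.cap u₀ := h.strictMonoOn_cap.monotoneOn ⟨hs.1.le, hs1⟩ hu₀mem hs.2
      rw [h.cap_timeChange ⟨ht0'.le, htS⟩] at h1
      linarith
    · rw [Real.coe_toNNReal _ hτ.le]
      exact h.tendsto_flow_sub_driving ⟨hs.1, hs1⟩

/-- A point of the slit of parameter `s ≤ σ(t)` lies in the hull at time `t ≤ S`. [folklore] -/
theorem apply_mem_hull_driving {t : ℝ≥0} (ht0 : 0 < t) (htS : (t : ℝ) ≤ h.capTime) {s : ℝ}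
    (hs0 : 0 < s) (hst : s ≤ h.timeChange t) : γ s ∈ Loewner.hull h.driving t := by
  rw [h.hull_driving_of_le ht0 htS]
  exact ⟨s, ⟨hs0, hst⟩, rfl⟩

/-- **`b(s) ≥ (im γ(s))²/2`**: the capacity of an initial arc dominates half the squared height
of its tip (the arc `γ(0, s]` is the hull at time `b(s)/2` of a Loewner chain,
`Loewner.im_sq_le_of_mem_hull`). [cite: Lawler2005, Ch. 4 §4.1 Thm. 4.6] -/
theorem im_sq_le_two_mul_cap {s : ℝ} (hs0 : 0 < s) (hs1 : s ≤ 1) : (γ s).im ^ 2 ≤ 2 * h.cap s := by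
  have hτ : 0 < h.cap s / 2 := by linarith [h.cap_pos hs0 hs1]
  set t : ℝ≥0 := (h.cap s / 2).toNNReal with ht
  have htcoe : (t : ℝ) = h.cap s / 2 := Real.coe_toNNReal _ hτ.le
  have ht0 : 0 < t := by
    change (0 : ℝ) < t
    rw [htcoe]; exact hτ
  have htS : (t : ℝ) ≤ h.capTime := by
    rw [htcoe]; exact h.cap_div_two_le_capTime ⟨hs0.le, hs1⟩
  have hσ : h.timeChange t = s := by
    rw [htcoe]; exact h.timeChange_cap_div_two ⟨hs0.le, hs1⟩
  have hmem : γ s ∈ Loewner.hull h.driving t := h.apply_mem_hull_driving ht0 htS hs0 hσ.ge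
  have key := Loewner.im_sq_le_of_mem_hull h.continuous_driving hmem
  rw [htcoe] at key
  linarith

/-! ### The initial piece of a slit -/

include h in
/-- **The initial piece `u ↦ γ(vu)` (`0 < v ≤ 1`) of a slit is a slit.** [folklore] -/
theorem initial {v : ℝ} (hv0 : 0 < v) (hv1 : v ≤ 1) : IsPlusSlit (fun u ↦ γ (v * u)) where
  continuousOn := h.continuousOn.comp (continuousOn_const.mul continuousOn_id) fun u hu ↦
    ⟨mul_nonneg hv0.le hu.1, mul_le_one₀ hv1 hu.1 hu.2⟩
  injOn s hs s' hs' heq := mul_left_cancel₀ hv0.ne'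
    (h.injOn ⟨mul_nonneg hv0.le hs.1, mul_le_one₀ hv1 hs.1 hs.2⟩
      ⟨mul_nonneg hv0.le hs'.1, mul_le_one₀ hv1 hs'.1 hs'.2⟩ heq)
  im_zero := by simp [h.im_zero]
  re_pos := by simp [h.re_pos]
  im_pos t ht := h.im_pos (v * t) ⟨mul_pos hv0 ht.1, mul_le_one₀ hv1 ht.1.le ht.2⟩

section Initial

variable {v : ℝ} (hv0 : 0 < v) (hv1 : v ≤ 1) (h' : IsPlusSlit (fun u ↦ γ (v * u)))

include hv0 in
/-- The hulls of the initial piece: `γ(v ·)[0, u] = γ[0, vu]`. [folklore] -/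
theorem hull_initial (u : ℝ) : h'.hull u = h.hull (v * u) := by
  simp only [hull_def]
  ext z
  constructor
  · rintro ⟨s, hs, rfl⟩
    exact ⟨v * s, ⟨mul_nonneg hv0.le hs.1, mul_le_mul_of_nonneg_left hs.2 hv0.le⟩, rfl⟩
  · rintro ⟨y, hy, rfl⟩
    refine ⟨y / v, ⟨div_nonneg hy.1 hv0.le, ?_⟩, ?_⟩
    · rw [div_le_iff₀ hv0]; linarith [hy.2]
    · simp only [mul_div_cancel₀ _ hv0.ne']

include hv0 hv1 in
/-- **The capacity of the initial piece: `b'(u) = b(vu)`** (`hcap` is intrinsic to the hull,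
`IsHydrodynamicMap.hcap_eq_hcap`). [cite: Lawler2005, §3.4 Prop. 3.36] -/
theorem cap_initial {u : ℝ} (hu : u ∈ Icc (0 : ℝ) 1) : h'.cap u = h.cap (v * u) := by
  rcases hu.1.eq_or_lt with heq | hu0
  · rw [← heq, mul_zero, h'.cap_zero, h.cap_zero]
  · have hvu0 : 0 < v * u := mul_pos hv0 hu0
    have hvu1 : v * u ≤ 1 := mul_le_one₀ hv1 hu.1 hu.2
    rw [h'.cap_eq hu0 hu.2, h.cap_eq hvu0 hvu1]
    exact IsHydrodynamicMap.hcap_eq_of_eq (h.hull_initial hv0 h' u) (h'.isHydrodynamicMap_gmap hu0 hu.2)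
      (h.isHydrodynamicMap_gmap hvu0 hvu1) (h'.isBounded_hull_inter hu.2)

include hv0 hv1 in
/-- The terminal capacity time of the initial piece is `b(v)/2`. [folklore] -/
theorem capTime_initial : h'.capTime = h.cap v / 2 := by
  rw [capTime, h.cap_initial hv0 hv1 h' ⟨zero_le_one, le_rfl⟩, mul_one]

include hv0 hv1 in
/-- `S' = b(v)/2 ≤ S`. [folklore] -/
theorem capTime_initial_le : h'.capTime ≤ h.capTime := by
  rw [h.capTime_initial hv0 hv1 h']
  exact h.cap_div_two_le_capTime ⟨hv0.le, hv1⟩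

include hv0 hv1 in
/-- **The time changes: `σ(t) = v σ'(t)` for `t ∈ [0, S']`.** [cite: Lawler2005, Remark 4.5] -/
theorem timeChange_initial {t : ℝ} (ht : t ∈ Icc 0 h'.capTime) :
    h.timeChange t = v * h'.timeChange t := by
  have htS : t ∈ Icc 0 h.capTime := ⟨ht.1, ht.2.trans (h.capTime_initial_le hv0 hv1 h')⟩
  have hσ' := h'.timeChange_mem ht
  refine h.strictMonoOn_cap.injOn (h.timeChange_mem htS)
    ⟨mul_nonneg hv0.le hσ'.1, mul_le_one₀ hv1 hσ'.1 hσ'.2⟩ ?_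
  rw [h.cap_timeChange htS, ← h.cap_initial hv0 hv1 h' hσ', h'.cap_timeChange ht]

include hv0 hv1 in
/-- **The maps: `g'_u = g_{vu}` on `ℍ ∖ γ[0, vu]`** (uniqueness of `g_A`). [cite: Lawler2005, §3.4 Prop. 3.36] -/
theorem gmap_initial {u : ℝ} (hu0 : 0 < u) (hu1 : u ≤ 1) :
    EqOn (h'.gmap hu0 hu1) (h.gmap (mul_pos hv0 hu0) (mul_le_one₀ hv1 hu0.le hu1))
      (upperHalfPlaneSet \ h'.hull u) :=
  IsHydrodynamicMap.eqOn_of_eq (h.hull_initial hv0 h' u) (h'.isHydrodynamicMap_gmap hu0 hu1)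
    (h.isHydrodynamicMap_gmap _ _) (h'.isBounded_hull_inter hu1)

include hv0 hv1 in
/-- **The driving values: `U'_u = U_{vu}` for `u ∈ (0, 1)`** (`U_u = lim_{t ↓ u} g_u(γ t)`,
Lemma 4.2, and `g'_u = g_{vu}`). [cite: Lawler2005, Lemma 4.2] -/
theorem drive_initial {u : ℝ} (hu0 : 0 < u) (hu1 : u < 1) : h'.drive u = h.drive (v * u) := by
  have hvu0 : 0 < v * u := mul_pos hv0 hu0
  have hvu1 : v * u < 1 := lt_of_le_of_lt (mul_le_of_le_one_left hu0.le hv1) hu1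
  have hA := h'.tendsto_gmap_drive hu0 hu1
  have hB := h.tendsto_gmap_drive hvu0 hvu1
  have hv : Tendsto (fun t : ℝ ↦ v * t) (𝓝[>] u) (𝓝[>] (v * u)) := by
    refine tendsto_nhdsWithin_of_tendsto_nhds_of_eventually_within _
      ((continuous_const.mul continuous_id).tendsto u |>.mono_left nhdsWithin_le_nhds) ?_
    filter_upwards [self_mem_nhdsWithin] with t ht
    exact mul_lt_mul_of_pos_left ht hv0
  have hB' := hB.comp hv
  have heq : (fun t ↦ h'.gmap hu0 hu1.le (γ (v * t))) =ᶠ[𝓝[>] u]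
      ((fun t ↦ h.gmap hvu0 hvu1.le (γ t)) ∘ fun t : ℝ ↦ v * t) := by
    filter_upwards [Ioc_mem_nhdsGT hu1] with t ht
    simp only [Function.comp_apply]
    exact h.gmap_initial hv0 hv1 h' hu0 hu1.le (h'.apply_mem_diff hu0.le ht.1 ht.2)
  have hlim := tendsto_nhds_unique (hA.congr' heq) hB'
  exact_mod_cast hlim

include hv0 hv1 in
/-- **Nested slits have the same driving function in capacity time**: `W' = W` on `[0, S']`,
`S' = b(v)/2` (on `(0, S')` by `W_t = U_{σ(t)}`, `σ = vσ'`, `U'_u = U_{vu}`; at the endpoints by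
continuity). [cite: Lawler2005, Prop. 4.4 (U_t) with Remark 4.5] -/
theorem driving_initial (t : ℝ≥0) (ht : (t : ℝ) ≤ h'.capTime) : h'.driving t = h.driving t := by
  -- as functions of a real time, on `(0, S')`
  have hIoo : EqOn (fun x : ℝ ↦ h'.driving x.toNNReal) (fun x : ℝ ↦ h.driving x.toNNReal)
      (Ioo 0 h'.capTime) := by
    intro x hx
    have hxS : x < h.capTime := hx.2.trans_le (h.capTime_initial_le hv0 hv1 h')
    simp only
    rw [h'.driving_toNNReal hx.1 hx.2, h.driving_toNNReal hx.1 hxS,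
      h.timeChange_initial hv0 hv1 h' ⟨hx.1.le, hx.2.le⟩]
    exact h.drive_initial hv0 hv1 h' (h'.timeChange_pos hx.1 hx.2.le) (h'.timeChange_lt_one hx.1.le hx.2)
  have hcl := hIoo.closure (h'.continuous_driving.comp continuous_real_toNNReal)
    (h.continuous_driving.comp continuous_real_toNNReal)
  rw [closure_Ioo h'.capTime_pos.ne] at hcl
  have := hcl ⟨t.2, ht⟩
  simpa using this

end Initial

end IsPlusSlit

end Literature.Probability.RandomPlanarGeometry
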